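import Summits.QuantumAdvantage.QuantumAdvantage.Theorems.ExactPairsMaioranaMcFarland.Negative.TwoAdicMutations

/-!
# A rind-5 cubic bent function outside MM# and the mutation of `stub_defect_vanishing` (crux stmt-QuantumAdvantage-2205)

Negative-side support file (drefute seat `refuter-drefute-stmt-QuantumAdvantage-2205-0`, 2026-08-16), line
`two-adic-local-nongeneric`.  The β-half stub `stub_defect_vanishing` says: for an exact CUBIC pair (`f`, `g` cubic,
`W_g = 2^m(−1)^f`) with an `m`-dimensional T-singular subspace (second derivatives CONSTANT), some `m`-dimensional
subspace has VANISHING second derivatives (Dillon's criterion, i.e. `g ∈ MM#`).  This file shows, kernel-checked, that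
the hypothesis "the dual `f` is cubic" cannot be dropped:

* `gStar` — an explicit cubic bent function on `𝔽₂¹⁰` of the affine-derivative shape `A(x) + y₁y₂ + y₂P(x)` (`A` a
  Maiorana–McFarland cubic bent function on `𝔽₂⁸`, `P` quadratic, `A + P` bent), found by the seat's family scan; its
  dual `dStar` has degree 4; `forrelation dStar gStar = 1`; `gStar_cubic`;
* `singular_gStar` — the 5-dimensional xor-closed `VStar = ⟨1, 4, 8, 82, 256⟩` on which all second derivatives of `gStar`
  are constant (rind gStar = 5);
* `gStar_not_dillon` — NO 5-dimensional subspace has all second derivatives zero (ind gStar = 4 < 5, so `gStar ∉ MM#`):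
  a two-stage pruning certificate on codes (`Phi` = "keep b with ≥ 32 partners", `Psi` = "keep b with ≥ 32 partners a
  having ≥ 32 common partners"), `Psi (Psi (Phi (Phi univ))) = ∅` by `native_decide`, plus the soundness lemmas
  `sub_Phi` / `sub_Psi` (a Dillon 32-set survives every stage);
* `defectVanishing_false_without_fCubic` — hence `stub_defect_vanishing` with "f cubic" dropped is FALSE (m = 5,
  g = gStar, f = dStar).  To our knowledge `gStar` is the first recorded cubic bent function outside the completed MM
  class with a 5-dimensional T-singular subspace (the Polujan–Pott outsiders `h¹⁰₃`, `h¹⁰₄` have rind 4).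

`native_decide` is used for the finite facts: the file is `computational`.
References: J. F. Dillon, PhD thesis (1974) (M-subspaces); A. Polujan, A. Pott, Des. Codes Cryptogr. 88 (2020),
arXiv:1908.11271, §2 (ind / r-ind); O. S. Rothaus, On "bent" functions, JCTA 20 (1976) (the `A, A+P` construction).
-/

set_option linter.dupNamespace false

namespace Summit.QuantumAdvantage.QuantumAdvantage.Theorems.ExactPairsMaioranaMcFarland.Negative.GStarWitness

open Literature.Computability.QuantumComplexity
open Literature.Computability.QuantumComplexity.BuzetChailloux (bxor)
open Summit.QuantumAdvantage.QuantumAdvantage.Theorems.ExactPairsMaioranaMcFarland.Negative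
open Summit.QuantumAdvantage.QuantumAdvantage.Theorems.ExactPairsMaioranaMcFarland.Negative.H104Pair
  (W_eq_of_forrelation_eq_one)
open Summit.QuantumAdvantage.QuantumAdvantage.Theorems.ExactPairsMaioranaMcFarland.Negative.TwoAdicMutations
  (SingularConclusionAt sdF)

/-! ### The witness and its dual -/

/-- The cubic bent function `g★` on `𝔽₂¹⁰` (affine-derivative family `A(x) + y₁y₂ + y₂P(x)`, drefute E3): outside MM#, rind 5. -/
def gStar (x : Fin 10 → Bool) : Bool :=
    x 0 ^^ x 2 ^^ x 3 ^^ (x 1 && x 4) ^^ (x 2 && x 4) ^^ (x 3 && x 4) ^^ (x 2 && x 5) ^^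
    (x 1 && x 4 && x 5) ^^ (x 2 && x 4 && x 5) ^^ (x 3 && x 6) ^^ (x 4 && x 6) ^^ (x 1 && x 5 && x 6) ^^
    (x 2 && x 5 && x 6) ^^ (x 4 && x 5 && x 6) ^^ x 7 ^^ (x 0 && x 7) ^^ (x 1 && x 7) ^^ (x 4 && x 7) ^^
    (x 1 && x 4 && x 7) ^^ (x 2 && x 4 && x 7) ^^ (x 1 && x 5 && x 7) ^^ (x 2 && x 5 && x 7) ^^
    (x 4 && x 5 && x 7) ^^ (x 1 && x 6 && x 7) ^^ (x 2 && x 6 && x 7) ^^ (x 4 && x 6 && x 7) ^^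
    (x 5 && x 6 && x 7) ^^ x 9 ^^ (x 1 && x 9) ^^ (x 0 && x 1 && x 9) ^^ (x 2 && x 9) ^^ (x 4 && x 9) ^^
    (x 2 && x 4 && x 9) ^^ (x 3 && x 4 && x 9) ^^ (x 0 && x 5 && x 9) ^^ (x 2 && x 5 && x 9) ^^
    (x 3 && x 5 && x 9) ^^ (x 6 && x 9) ^^ (x 0 && x 6 && x 9) ^^ (x 2 && x 6 && x 9) ^^
    (x 3 && x 6 && x 9) ^^ (x 5 && x 6 && x 9) ^^ (x 1 && x 7 && x 9) ^^ (x 2 && x 7 && x 9) ^^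
    (x 3 && x 7 && x 9) ^^ (x 4 && x 7 && x 9) ^^ (x 8 && x 9)

/-- The dual of `g★` (ANF of degree 4, 58 monomials). -/
def dStar (x : Fin 10 → Bool) : Bool :=
    true ^^ x 0 ^^ x 2 ^^ (x 0 && x 2) ^^ x 3 ^^ (x 0 && x 3) ^^ (x 1 && x 3) ^^ (x 1 && x 2 && x 3) ^^
    (x 0 && x 4) ^^ (x 1 && x 4) ^^ (x 0 && x 1 && x 4) ^^ (x 0 && x 2 && x 4) ^^ (x 3 && x 4) ^^
    (x 1 && x 3 && x 4) ^^ (x 2 && x 3 && x 4) ^^ (x 0 && x 5) ^^ (x 1 && x 5) ^^ (x 2 && x 5) ^^ x 6 ^^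
    (x 0 && x 6) ^^ (x 1 && x 6) ^^ (x 0 && x 1 && x 6) ^^ (x 0 && x 2 && x 6) ^^ (x 1 && x 3 && x 6) ^^
    (x 2 && x 3 && x 6) ^^ x 7 ^^ (x 0 && x 7) ^^ (x 0 && x 1 && x 8) ^^ (x 0 && x 2 && x 8) ^^
    (x 2 && x 3 && x 8) ^^ (x 0 && x 2 && x 3 && x 8) ^^ (x 0 && x 1 && x 4 && x 8) ^^ (x 2 && x 4 && x 8) ^^
    (x 0 && x 2 && x 4 && x 8) ^^ (x 3 && x 4 && x 8) ^^ (x 2 && x 3 && x 4 && x 8) ^^ (x 5 && x 8) ^^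
    (x 2 && x 5 && x 8) ^^ (x 3 && x 5 && x 8) ^^ (x 1 && x 3 && x 5 && x 8) ^^ (x 3 && x 4 && x 5 && x 8) ^^
    (x 6 && x 8) ^^ (x 0 && x 6 && x 8) ^^ (x 1 && x 6 && x 8) ^^ (x 0 && x 1 && x 6 && x 8) ^^
    (x 0 && x 2 && x 6 && x 8) ^^ (x 1 && x 3 && x 6 && x 8) ^^ (x 4 && x 6 && x 8) ^^
    (x 3 && x 4 && x 6 && x 8) ^^ (x 5 && x 6 && x 8) ^^ (x 3 && x 5 && x 6 && x 8) ^^ (x 7 && x 8) ^^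
    (x 1 && x 7 && x 8) ^^ (x 1 && x 3 && x 7 && x 8) ^^ (x 3 && x 4 && x 7 && x 8) ^^ (x 6 && x 7 && x 8) ^^
    (x 3 && x 6 && x 7 && x 8) ^^ (x 8 && x 9)

/-- the 47 monomials of `g★` as index triples (repeated indices encode lower-degree monomials; `x² = x` on 0/1 points) -/
def tripStar : Finset (Fin 10 × Fin 10 × Fin 10) :=
  {(0, 0, 0), (2, 2, 2), (3, 3, 3), (1, 4, 4), (2, 4, 4), (3, 4, 4), (2, 5, 5), (1, 4, 5), (2, 4, 5), (3, 6, 6), (4, 6, 6), (1, 5, 6), (2, 5, 6), (4, 5, 6), (7, 7, 7), (0, 7, 7), (1, 7, 7), (4, 7, 7), (1, 4, 7), (2, 4, 7), (1, 5, 7), (2, 5, 7), (4, 5, 7), (1, 6, 7), (2, 6, 7), (4, 6, 7), (5, 6, 7), (9, 9, 9), (1, 9, 9), (0, 1, 9), (2, 9, 9), (4, 9, 9), (2, 4, 9), (3, 4, 9), (0, 5, 9), (2, 5, 9), (3, 5, 9), (6, 9, 9), (0, 6, 9), (2, 6, 9), (3, 6, 9), (5, 6, 9), (1, 7, 9), (2,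 7, 9), (3, 7, 9), (4, 7, 9), (8, 9, 9)}

/-- truth table of `gStar` on codes -/
def gsTbl : Array Bool := Array.ofFn fun k : Fin 1024 => gStar (dec k)
/-- truth table of `dStar` on codes -/
def dsTbl : Array Bool := Array.ofFn fun k : Fin 1024 => dStar (dec k)
/-- table version of `gStar` -/
def gsT (k : ℕ) : Bool := gsTbl.getD k false
/-- table version of `dStar` -/
def dsT (k : ℕ) : Bool := dsTbl.getD k false

/-- the table agrees with `gStar` on codes `< 1024` -/
theorem gsT_eq (k : ℕ) (hk : k < 1024) : gsT k = gStar (dec k) := by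
  simp [gsT, gsTbl, hk]

/-- the table agrees with `dStar` on codes `< 1024` -/
theorem dsT_eq (k : ℕ) (hk : k < 1024) : dsT k = dStar (dec k) := by
  simp [dsT, dsTbl, hk]

/-- `Σ_{x,y} (-1)^{dStar x} (-1)^{x·y} (-1)^{gStar y}` on codes -/
def forrNumS : ℤ := ∑ a : Fin 1024, ∑ b : Fin 1024, sgnZ (dsT a) * twistZ (dec a) (dec b) * sgnZ (gsT b)

/-- the forrelation double sum of `(dStar, gStar)` is `2^15` -/
theorem forrNumS_eq : forrNumS = 32768 := by native_decide

/-- `dStar` is exactly forrelated with `gStar` (it is the dual of the bent `gStar`). -/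
theorem forrelation_dStar_gStar : forrelation dStar gStar = 1 := by
  unfold forrelation
  have hs : ∑ x : Fin 10 → Bool, ∑ y : Fin 10 → Bool, signOf (dStar x) * twist x y * signOf (gStar y)
      = (forrNumS : ℝ) := by
    unfold forrNumS
    push_cast
    rw [← Equiv.sum_comp E]
    refine Finset.sum_congr rfl fun a _ => ?_
    rw [← Equiv.sum_comp E]
    refine Finset.sum_congr rfl fun b _ => ?_
    rw [E_apply, E_apply, signOf_eq_cast, signOf_eq_cast, twist_eq_cast, gsT_eq _ b.isLt, dsT_eq _ a.isLt]
  rw [hs, forrNumS_eq]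
  have hsq : Real.sqrt (2 ^ (3 * 10)) = 32768 := by
    rw [show ((2 : ℝ) ^ (3 * 10)) = 32768 ^ 2 by norm_num]
    exact Real.sqrt_sq (by norm_num)
  rw [hsq]
  norm_num

/-- `gStar` is bent with dual exactly `dStar`, in the Walsh form used by the line's stubs. -/
theorem W_gStar (b : Fin (5 + 5) → Bool) :
    DerivativeWalsh.W (fun x => signOf (gStar x)) b = (2 : ℝ) ^ 5 * signOf (dStar b) :=
  W_eq_of_forrelation_eq_one 5 dStar gStar forrelation_dStar_gStar b

/-! ### `gStar` is cubic -/

open MvPolynomial in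
/-- `gStar` as a polynomial over `ZMod 2` (products of three, possibly repeated, variables) -/
noncomputable def pS : MvPolynomial (Fin 10) (ZMod 2) :=
  ∑ t ∈ tripStar, X t.1 * X t.2.1 * X t.2.2

open MvPolynomial in
/-- `pS` has total degree at most 3 -/
theorem pS_totalDegree : pS.totalDegree ≤ 3 := by
  refine (MvPolynomial.totalDegree_finsetSum _ _).trans (Finset.sup_le fun t _ => ?_)
  calc (X t.1 * X t.2.1 * X t.2.2 : MvPolynomial (Fin 10) (ZMod 2)).totalDegree
      ≤ (X t.1 * X t.2.1 : MvPolynomial (Fin 10) (ZMod 2)).totalDegree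
          + (X t.2.2 : MvPolynomial (Fin 10) (ZMod 2)).totalDegree := totalDegree_mul _ _
    _ ≤ ((X t.1 : MvPolynomial (Fin 10) (ZMod 2)).totalDegree
          + (X t.2.1 : MvPolynomial (Fin 10) (ZMod 2)).totalDegree)
          + (X t.2.2 : MvPolynomial (Fin 10) (ZMod 2)).totalDegree := by
        gcongr; exact totalDegree_mul _ _
    _ = 3 := by simp [totalDegree_X]

/-- evaluation of `pS` at a 0/1 point -/
theorem pS_eval (x : Fin 10 → Bool) :
    MvPolynomial.eval (fun j => if x j then (1 : ZMod 2) else 0) pS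
      = ∑ t ∈ tripStar, (ind x t.1) * (ind x t.2.1) * (ind x t.2.2) := by
  simp [pS, map_sum, map_mul, MvPolynomial.eval_X, ind]

/-- `gStar` agrees with the monomial sum pointwise -/
theorem gStar_eq_sum : ∀ x : Fin 10 → Bool,
    gStar x = decide ((∑ t ∈ tripStar, (ind x t.1) * (ind x t.2.1) * (ind x t.2.2)) = 1) := by
  native_decide

/-- `gStar` has an ANF of degree ≤ 3, in the crux's `MvPolynomial` phrasing. -/
theorem gStar_cubic : ∃ p : MvPolynomial (Fin (5 + 5)) (ZMod 2), p.totalDegree ≤ 3 ∧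
    ∀ x, gStar x = decide (MvPolynomial.eval (fun j => if x j then (1 : ZMod 2) else 0) p = 1) :=
  ⟨pS, pS_totalDegree, fun x => by rw [pS_eval]; exact gStar_eq_sum x⟩

/-! ### rind gStar = 5: an explicit T-singular 5-space -/

/-- codes of the span of the basis `1, 4, 8, 82, 256`, indexed by `k < 32` -/
def spanV (k : Fin 32) : ℕ :=
  (if k.val.testBit 0 then 1 else 0) ^^^ (if k.val.testBit 1 then 4 else 0) ^^^ (if k.val.testBit 2 then 8 else 0) ^^^
    (if k.val.testBit 3 then 82 else 0) ^^^ (if k.val.testBit 4 then 256 else 0)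

/-- the T-singular subspace `VStar = ⟨1, 4, 8, 82, 256⟩` of `gStar` -/
def VStar : Finset (Fin (5 + 5) → Bool) := Finset.univ.image fun k : Fin 32 => dec (spanV k)

/-- `VStar` is closed under xor -/
theorem VStar_xor : ∀ a ∈ VStar, ∀ b ∈ VStar, bxor a b ∈ VStar := by native_decide

/-- `VStar` has 32 elements -/
theorem VStar_card : VStar.card = 2 ^ 5 := by native_decide

/-- all second derivatives of `gStar` along `VStar` are constant (checked on codes) -/
theorem VStar_const_code : ∀ ka kb : Fin 32, ∀ k : Fin 1024,
    sdF gStar (dec (spanV ka)) (dec (spanV kb)) k = sdF gStar (dec (spanV ka)) (dec (spanV kb)) 0 := by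
  native_decide

/-- every bit-vector is the decoding of its code -/
theorem dec_code (x : Fin 10 → Bool) : dec (code x) = x := funext (dec_code_apply x)

/-- rind gStar = 5: the conclusion of `stub_local_to_global` (= hypothesis of `stub_defect_vanishing`) holds for `gStar`. -/
theorem singular_gStar : SingularConclusionAt 5 gStar := by
  refine ⟨VStar, VStar_xor, VStar_card, ?_⟩
  intro a ha b hb x y
  simp only [VStar, Finset.mem_image, Finset.mem_univ, true_and] at ha hb
  obtain ⟨ka, rfl⟩ := ha
  obtain ⟨kb, rfl⟩ := hb
  have hx := VStar_const_code ka kb ⟨code x, code_lt x⟩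
  have hy := VStar_const_code ka kb ⟨code y, code_lt y⟩
  simp only [sdF, dec_code] at hx hy
  rw [hx, hy]

/-! ### ind gStar < 5: the pruning certificate on codes -/

/-- sampled zero test of the second derivative of `gStar` on codes (exact for cubic functions) -/
def Rz (a b : Fin 1024) : Bool := compatT gsT a b

/-- vertex refinement: keep the directions with at least 32 partners inside `S` -/
def Phi (S : Finset (Fin 1024)) : Finset (Fin 1024) :=
  S.filter fun b => 32 ≤ (S.filter fun a => Rz a b = true).card

/-- pair refinement: keep the directions with at least 32 partners `a` having at least 32 common partners inside `S` -/
def Psi (S : Finset (Fin 1024)) : Finset (Fin 1024) :=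
  S.filter fun b => 32 ≤ (S.filter fun a => Rz a b = true ∧
    32 ≤ (S.filter fun c => Rz c a = true ∧ Rz c b = true).card).card

/-- the certificate: two vertex rounds and two pair rounds empty the candidate set -/
theorem chain_empty : Psi (Psi (Phi (Phi Finset.univ))) = ∅ := by native_decide

/-- a Dillon 32-set on codes: 32 directions, pairwise passing the zero test -/
def DillonCode (W : Finset (Fin 1024)) : Prop := W.card = 32 ∧ ∀ a ∈ W, ∀ b ∈ W, Rz a b = true

/-- a Dillon 32-set inside `S` survives the vertex refinement -/
theorem sub_Phi {W S : Finset (Fin 1024)} (hW : DillonCode W) (hS : W ⊆ S) : W ⊆ Phi S := by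
  intro b hb
  simp only [Phi, Finset.mem_filter]
  refine ⟨hS hb, ?_⟩
  calc 32 = W.card := hW.1.symm
    _ ≤ _ := Finset.card_le_card fun a ha => Finset.mem_filter.2 ⟨hS ha, hW.2 a ha b hb⟩

/-- a Dillon 32-set inside `S` survives the pair refinement -/
theorem sub_Psi {W S : Finset (Fin 1024)} (hW : DillonCode W) (hS : W ⊆ S) : W ⊆ Psi S := by
  intro b hb
  simp only [Psi, Finset.mem_filter]
  refine ⟨hS hb, ?_⟩
  calc 32 = W.card := hW.1.symm
    _ ≤ _ := Finset.card_le_card fun a ha => Finset.mem_filter.2 ⟨hS ha, hW.2 a ha b hb, by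
        calc 32 = W.card := hW.1.symm
          _ ≤ _ := Finset.card_le_card fun c hc => Finset.mem_filter.2 ⟨hS hc, hW.2 c hc a ha, hW.2 c hc b hb⟩⟩

/-- no Dillon 32-set on codes -/
theorem no_dillonCode (W : Finset (Fin 1024)) (hW : DillonCode W) : False := by
  have h : W ⊆ Psi (Psi (Phi (Phi Finset.univ))) :=
    sub_Psi hW (sub_Psi hW (sub_Phi hW (sub_Phi hW (Finset.subset_univ W))))
  rw [chain_empty, Finset.subset_empty] at h
  have := hW.1
  rw [h, Finset.card_empty] at this
  exact absurd this (by norm_num)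

/-- The conclusion of `stub_defect_vanishing` at a general `m` (verbatim shape): an xor-closed `V` with `|V| = 2^m` on
which every second derivative VANISHES (Dillon's criterion for the completed MM class). -/
def DillonConclusionAt (m : ℕ) (g : (Fin (m + m) → Bool) → Bool) : Prop :=
  ∃ V : Finset (Fin (m + m) → Bool), (∀ a ∈ V, ∀ b ∈ V, bxor a b ∈ V) ∧ V.card = 2 ^ m ∧
    ∀ a ∈ V, ∀ b ∈ V, ∀ x : Fin (m + m) → Bool,
      (g x ^^ g (bxor x a) ^^ g (bxor x b) ^^ g (bxor (bxor x a) b)) = false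

/-- ind gStar < 5: `gStar` has no 5-dimensional subspace with vanishing second derivatives (so `gStar ∉ MM#`). -/
theorem gStar_not_dillon : ¬ DillonConclusionAt 5 gStar := by
  rintro ⟨V, -, hV, hD⟩
  refine no_dillonCode (V.map E.symm.toEmbedding) ⟨by rw [Finset.card_map, hV]; norm_num, ?_⟩
  intro a ha b hb
  simp only [Finset.mem_map_equiv, Equiv.symm_symm] at ha hb
  have key : compatF gStar (E a) (E b) := fun k _ => hD (E a) ha (E b) hb (dec k)
  exact (compat_transfer gStar gsT gsT_eq a b).1 key

/-! ### The mutation of `stub_defect_vanishing` -/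

/-- `stub_defect_vanishing` with the hypothesis "the dual `f` is cubic" DROPPED. -/
def DefectVanishingWithoutFCubic : Prop :=
  ∀ (m : ℕ) (f g : (Fin (m + m) → Bool) → Bool),
    (∃ p : MvPolynomial (Fin (m + m)) (ZMod 2), p.totalDegree ≤ 3 ∧
      ∀ x, g x = decide (MvPolynomial.eval (fun j => if x j then (1 : ZMod 2) else 0) p = 1)) →
    (∀ b : Fin (m + m) → Bool, DerivativeWalsh.W (fun x => signOf (g x)) b = (2 : ℝ) ^ m * signOf (f b)) →
    SingularConclusionAt m g → DillonConclusionAt m g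

/-- Any proof of `stub_defect_vanishing` must use that the dual `f` is cubic: `gStar` is cubic and bent (quartic dual
`dStar`), has a 5-dimensional T-singular subspace, and no 5-dimensional Dillon subspace. -/
theorem defectVanishing_false_without_fCubic : ¬ DefectVanishingWithoutFCubic :=
  fun h => gStar_not_dillon (h 5 dStar gStar gStar_cubic W_gStar singular_gStar)

end Summit.QuantumAdvantage.QuantumAdvantage.Theorems.ExactPairsMaioranaMcFarland.Negative.GStarWitness
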